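import Literature.NumberTheory.Automorphic.LevelActionTwoLevelHecke
import Literature.NumberTheory.Automorphic.HidaLatticeDiamondAction
import HarnessLib

/-!
# `res` / `tr` between the levels `U(b,c) ⊴ U(b',c)` on `H^i(·, ⨂_τ Sym^{k−2}(𝒪²))`

Topic `NumberTheory/Automorphic`; namespaces `Literature.NumberTheory.Automorphic.LevelAction`
(generic complements to `LevelActionTwoLevelHecke`: transversals given by a family `d : T → 𝒢`,
e.g. diamonds) and `…ParallelWeight` (the instance); definitions with bodies and theorems.  The
finite-level control mechanism of Hida theory in the coefficients-at-`p` model ([Hida1994AIF, §2];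
[KhareThorne2017, §6.3]) for the `p`-adic lattice cohomology `H(b) = H^i(U(b,c), ⨂_τ Sym^{k−2}(𝒪²))`
of a tame level maximal above `p` (`b' ≤ b ≤ c`, `max b' c ≥ 1`), using the diamond transversal
`exists_diamond_transversal` of `U(b',c)/U(b,c) ≅ T(b')/T(b)`:

* `latticeRes`, `latticeTr` — restriction `H(b') → H(b)` and transfer `H(b) → H(b')`;
* **`latticeTr_latticeRes`: `tr ∘ res = [U(b',c) : U(b,c)]`**;
* **`latticeRes_latticeTr`: `res ∘ tr = ∑_{u ∈ S} ⟨u⟩`**, the norm of the diamond action of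
  `T(b')/T(b)` (`S` a diamond transversal);
* **`latticeDiamond_latticeRes`: `⟨u⟩ ∘ res = res` for `u ∈ T(b')`** — `res` lands in the
  `T(b')/T(b)`-invariants.

## References

* H. Hida, Ann. Inst. Fourier 44 (1994), §2 (held). [Hida1994AIF]
* C. Khare, J. A. Thorne, Amer. J. Math. 139 (2017), §6.3 (arXiv:1409.7007, held). [KhareThorne2017]
-/

noncomputable section

open CategoryTheory IsDedekindDomain NumberField

namespace Literature.NumberTheory.Automorphic

namespace LevelAction

/-! ### Generic: transversals given by a family, `res` lands in invariants -/

section Generic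

variable {R : Type} [CommRing R] {Γ 𝒢 : Type} [Group Γ] [Group 𝒢] (ι : Γ →* 𝒢) (Δ : Submonoid 𝒢)
  {V : Type} [AddCommGroup V] [Module R V] (τ : Δ →* Module.End R V) {U U' : Subgroup 𝒢}
  (hU : U.toSubmonoid ≤ Δ) (hU' : U'.toSubmonoid ≤ Δ) (hle : U ≤ U')

open scoped Classical in
omit [Group Γ] in
/-- A transversal parametrised by a family `d : T → 𝒢` gives a transversal of group elements. [folklore] -/
theorem bijOn_image_coe {T : Type} (d : T → 𝒢) {S : Finset T}
    (hS : Set.BijOn (fun t => (d t : 𝒢 ⧸ U)) S (ArithmeticQuotient.doubleCosetQuot₂ U' U 1)) :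
    Set.BijOn (fun s : 𝒢 => (s : 𝒢 ⧸ U)) (S.image d : Finset 𝒢) (ArithmeticQuotient.doubleCosetQuot₂ U' U 1) := by
  refine ⟨?_, ?_, ?_⟩
  · intro s hs
    rw [Finset.coe_image] at hs
    obtain ⟨u, hu, rfl⟩ := hs
    exact hS.mapsTo hu
  · intro s hs s' hs' h
    rw [Finset.coe_image] at hs hs'
    obtain ⟨u, hu, rfl⟩ := hs
    obtain ⟨u', hu', rfl⟩ := hs'
    rw [hS.injOn hu hu' h]
  · intro c hc
    obtain ⟨u, hu, rfl⟩ := hS.surjOn hc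
    exact ⟨d u, by rw [Finset.coe_image]; exact ⟨u, hu, rfl⟩, rfl⟩

omit [Group Γ] in
/-- The parametrising family is injective on the transversal. [folklore] -/
theorem injOn_of_bijOn_family {T : Type} (d : T → 𝒢) {S : Finset T}
    (hS : Set.BijOn (fun t => (d t : 𝒢 ⧸ U)) S (ArithmeticQuotient.doubleCosetQuot₂ U' U 1)) :
    Set.InjOn d S := fun u hu u' hu' h => hS.injOn hu hu' (by simp only [h])

/-- **`tr ≫ res = ∑_{t ∈ S} [U d(t) U]`** for `U ⊴ U'` and a transversal `d(S)` of `U'/U` given by a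
family `d : T → Δ`. [cite: Hida1994AIF, §2] -/
theorem trRepHom_comp_resRepHom_family (hN : ∀ u' ∈ U', ∀ u ∈ U, u'⁻¹ * u * u' ∈ U)
    {T : Type} (d : T → 𝒢) (hd : ∀ t, d t ∈ Δ) {S : Finset T}
    (hS : Set.BijOn (fun t => (d t : 𝒢 ⧸ U)) S (ArithmeticQuotient.doubleCosetQuot₂ U' U 1)) :
    trRepHom ι Δ τ hU hU' ≫ resRepHom ι Δ τ hle = ∑ t ∈ S, heckeRepHom ι Δ τ U hU (hd t) := by
  classical
  refine Rep.hom_ext (Representation.IntertwiningMap.ext (LinearMap.ext fun f => ?_))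
  change (resRepHom ι Δ τ hle).hom ((trRepHom ι Δ τ hU hU').hom f) = _
  refine Subtype.ext ?_
  rw [resRepHom_hom_apply_coe, trRepHom_hom_apply_coe,
    heckeOp₂_one_apply_eq_sum_heckeOp hU hU' hle hN (bijOn_image_coe d hS) f.2,
    Finset.sum_image fun u hu u' hu' h => injOn_of_bijOn_family d hS hu hu' h, Rep.sum_hom,
    Representation.IntertwiningMap.toLinearMap_sum, LinearMap.sum_apply, AddSubmonoidClass.coe_finsetSum]
  rfl

/-- **`res ∘ tr = ∑_{t ∈ S} [U d(t) U]` on `H^i(U, τ)`** (family version). [cite: Hida1994AIF, §2] -/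
theorem resCohomology_trCohomology_family (hN : ∀ u' ∈ U', ∀ u ∈ U, u'⁻¹ * u * u' ∈ U)
    {T : Type} (d : T → 𝒢) (hd : ∀ t, d t ∈ Δ) {S : Finset T}
    (hS : Set.BijOn (fun t => (d t : 𝒢 ⧸ U)) S (ArithmeticQuotient.doubleCosetQuot₂ U' U 1)) (i : ℕ) :
    trCohomology ι Δ τ hU hU' i ≫ resCohomology ι Δ τ hle i =
      ∑ t ∈ S, groupCohomology.map (MonoidHom.id Γ) (heckeRepHom ι Δ τ U hU (hd t)) i := by
  rw [resCohomology, trCohomology, ← groupCohomology.map_id_comp,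
    trRepHom_comp_resRepHom_family ι Δ τ hU hU' hle hN d hd hS, ArithmeticQuotient.map_id_sum]

omit [Group Γ] in
/-- A transversal given by a family has `[U' : U]` elements. [folklore] -/
theorem card_eq_relIndex_family {T : Type} (d : T → 𝒢) {S : Finset T}
    (hS : Set.BijOn (fun t => (d t : 𝒢 ⧸ U)) S (ArithmeticQuotient.doubleCosetQuot₂ U' U 1)) :
    S.card = U.relIndex U' := by
  rw [← ArithmeticQuotient.ncard_doubleCosetQuot₂_one, ← hS.image_eq, hS.injOn.ncard_image,
    Set.ncard_coe_finset]

/-- **`tr ∘ res = [U' : U]` on `H^i(U', τ)`** (given a transversal by a family). [cite: Hida1994AIF, §2] -/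
theorem trCohomology_resCohomology_family {T : Type} (d : T → 𝒢) {S : Finset T}
    (hS : Set.BijOn (fun t => (d t : 𝒢 ⧸ U)) S (ArithmeticQuotient.doubleCosetQuot₂ U' U 1)) (i : ℕ) :
    resCohomology ι Δ τ hle i ≫ trCohomology ι Δ τ hU hU' i = U.relIndex U' • 𝟙 _ := by
  classical
  rw [trCohomology_resCohomology ι Δ τ hU hU' hle (bijOn_image_coe d hS) i,
    ArithmeticQuotient.card_eq_relIndex_of_bijOn (bijOn_image_coe d hS)]

/-- **`[U α U] ∘ res = res` for `α ∈ U'` normalising `U`**: `res` lands in the invariants of the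
`U'/U`-action. [cite: KhareThorne2017, §6.3] -/
theorem resRepHom_comp_heckeRepHom_of_mem {α : 𝒢} (hα : α ∈ U') (hαn : ∀ u ∈ U, α⁻¹ * u * α ∈ U) :
    resRepHom ι Δ τ hle ≫ heckeRepHom ι Δ τ U hU (hU' hα) = resRepHom ι Δ τ hle := by
  refine Rep.hom_ext (Representation.IntertwiningMap.ext (LinearMap.ext fun f => ?_))
  change (heckeRepHom ι Δ τ U hU (hU' hα)).hom ((resRepHom ι Δ τ hle).hom f) = _
  refine Subtype.ext ?_
  rw [heckeRepHom_hom_apply_coe, resRepHom_hom_apply_coe,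
    heckeOp_apply_of_normalizing hU (hU' hα) hαn (sections_mono Δ τ hle f.2)]
  exact f.2 _ hα

/-- The same on cohomology. [cite: KhareThorne2017, §6.3] -/
theorem resCohomology_heckeCohomology_of_mem {α : 𝒢} (hα : α ∈ U') (hαn : ∀ u ∈ U, α⁻¹ * u * α ∈ U) (i : ℕ) :
    resCohomology ι Δ τ hle i ≫ groupCohomology.map (MonoidHom.id Γ) (heckeRepHom ι Δ τ U hU (hU' hα)) i =
      resCohomology ι Δ τ hle i := by
  rw [resCohomology, ← groupCohomology.map_id_comp, resRepHom_comp_heckeRepHom_of_mem ι Δ τ hU hU' hle hα hαn]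

end Generic

end LevelAction

namespace ParallelWeight

open BigHeckeGLn IntegralWeightGL2 LevelAction

variable (F : Type) [Field F] [NumberField F] (k : ℕ) (p : ℕ) [Fact p.Prime] {𝒰 : TameLevel 2 F p}

/-- `U(b, c) ≤ U(b', c)` for `b' ≤ b`. [folklore] -/
theorem level_le_level {b b' : ℕ} (hb : b' ≤ b) (c : ℕ) : 𝒰.level b c ≤ 𝒰.level b' c :=
  𝒰.level_antitone hb le_rfl

variable (𝒰) in
/-- **`res : H^i(U(b',c), ⨂Sym(𝒪²)) → H^i(U(b,c), ⨂Sym(𝒪²))`** (`b' ≤ b`). [cite: Hida1994AIF, §2] -/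
abbrev latticeRes {b b' : ℕ} (hb : b' ≤ b) (c i : ℕ) :
    LevelAction.cohomology (globalEmbedding 2 F) (integralMonoid F (padicPlace F p))
        (symLatticeAction (padicEmbInt F p) (PadicAlgCl p) F k (padicPlace F p) (padicEmbIntHom F p)) (𝒰.level b' c) i ⟶
      LevelAction.cohomology (globalEmbedding 2 F) (integralMonoid F (padicPlace F p))
        (symLatticeAction (padicEmbInt F p) (PadicAlgCl p) F k (padicPlace F p) (padicEmbIntHom F p)) (𝒰.level b c) i :=
  resCohomology (globalEmbedding 2 F) (integralMonoid F (padicPlace F p)) _ (level_le_level F p hb c) i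

variable (𝒰) in
/-- **`tr : H^i(U(b,c), ⨂Sym(𝒪²)) → H^i(U(b',c), ⨂Sym(𝒪²))`**, the transfer `[U(b',c) 1 U(b,c)]`.
[cite: Hida1994AIF, §2] -/
abbrev latticeTr (b b' c i : ℕ) :
    LevelAction.cohomology (globalEmbedding 2 F) (integralMonoid F (padicPlace F p))
        (symLatticeAction (padicEmbInt F p) (PadicAlgCl p) F k (padicPlace F p) (padicEmbIntHom F p)) (𝒰.level b c) i ⟶
      LevelAction.cohomology (globalEmbedding 2 F) (integralMonoid F (padicPlace F p))
        (symLatticeAction (padicEmbInt F p) (PadicAlgCl p) F k (padicPlace F p) (padicEmbIntHom F p)) (𝒰.level b' c) i :=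
  trCohomology (globalEmbedding 2 F) (integralMonoid F (padicPlace F p)) _
    (level_le_integralMonoid F p 𝒰 b c) (level_le_integralMonoid F p 𝒰 b' c) i

/-- **`tr ∘ res = [U(b',c) : U(b,c)]`** on `H^i(U(b',c), ⨂Sym(𝒪²))` (`b' ≤ b ≤ c`, `max b' c ≥ 1`,
`U` maximal above `p`). [cite: Hida1994AIF, §2] [cite: KhareThorne2017, §6.3] -/
theorem latticeTr_latticeRes (h𝒰 : 𝒰.IsMaximalAbove) {b b' c : ℕ} (hb : b' ≤ b) (hbc : b ≤ c)
    (h1 : 1 ≤ max b' c) (i : ℕ) :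
    latticeRes F k p 𝒰 hb c i ≫ latticeTr F k p 𝒰 b b' c i = (𝒰.level b c).relIndex (𝒰.level b' c) • 𝟙 _ := by
  obtain ⟨S, -, hS⟩ := 𝒰.exists_diamond_transversal h𝒰 hbc h1
  exact trCohomology_resCohomology_family _ _ _ _ _ _ (diamondPi 2 F p) hS i

/-- `tr (res x) = [U(b',c) : U(b,c)] • x`. [cite: Hida1994AIF, §2] -/
theorem latticeTr_latticeRes_apply (h𝒰 : 𝒰.IsMaximalAbove) {b b' c : ℕ} (hb : b' ≤ b) (hbc : b ≤ c)
    (h1 : 1 ≤ max b' c) (i : ℕ)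
    (x : LevelAction.cohomology (globalEmbedding 2 F) (integralMonoid F (padicPlace F p))
        (symLatticeAction (padicEmbInt F p) (PadicAlgCl p) F k (padicPlace F p) (padicEmbIntHom F p)) (𝒰.level b' c) i) :
    (latticeTr F k p 𝒰 b b' c i).hom ((latticeRes F k p 𝒰 hb c i).hom x) =
      (𝒰.level b c).relIndex (𝒰.level b' c) • x := by
  have h' := congrArg ModuleCat.Hom.hom (latticeTr_latticeRes F k p h𝒰 hb hbc h1 i)
  rw [ModuleCat.hom_comp, ModuleCat.hom_nsmul, ModuleCat.hom_id] at h'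
  simpa using LinearMap.congr_fun h' x

/-- **`res ∘ tr = ∑_{u ∈ S} ⟨u⟩`** on `H^i(U(b,c), ⨂Sym(𝒪²))` for a diamond transversal `S` of
`U(b',c)/U(b,c)` (the norm of the `T(b')/T(b)`-action; `⟨u⟩ = H^i([U diamondPi(u) U])`).
[cite: Hida1994AIF, §2] [cite: KhareThorne2017, §6.3] -/
theorem latticeRes_latticeTr {b b' c : ℕ} (hb : b' ≤ b) (hbc : b ≤ c)
    {S : Finset (∀ w : PlacesAbove F p, (Fin 2 → (w.1.adicCompletionIntegers F)ˣ))}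
    (hS : Set.BijOn (fun u => (diamondPi 2 F p u : FiniteAdelicGL 2 F ⧸ 𝒰.level b c)) S
      (ArithmeticQuotient.doubleCosetQuot₂ (𝒰.level b' c) (𝒰.level b c) 1)) (i : ℕ) :
    latticeTr F k p 𝒰 b b' c i ≫ latticeRes F k p 𝒰 hb c i =
      ∑ u ∈ S, groupCohomology.map (MonoidHom.id _) (heckeRepHom (globalEmbedding 2 F)
        (integralMonoid F (padicPlace F p))
        (symLatticeAction (padicEmbInt F p) (PadicAlgCl p) F k (padicPlace F p) (padicEmbIntHom F p)) (𝒰.level b c)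
        (level_le_integralMonoid F p 𝒰 b c) (diamondPi_mem_integralMonoid F p u)) i :=
  resCohomology_trCohomology_family _ _ _ _ _ _ (fun _ hu' _ hu => 𝒰.conj_mem_level hb hbc hu' hu)
    (diamondPi 2 F p) (diamondPi_mem_integralMonoid F p) hS i

/-- `res (tr x) = ∑_{u ∈ S} ⟨u⟩ x`. [cite: Hida1994AIF, §2] [cite: KhareThorne2017, §6.3] -/
theorem latticeRes_latticeTr_apply (h𝒰 : 𝒰.IsMaximalAbove) {b b' c : ℕ} (hb : b' ≤ b) (hbc : b ≤ c)
    {S : Finset (∀ w : PlacesAbove F p, (Fin 2 → (w.1.adicCompletionIntegers F)ˣ))}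
    (hS : Set.BijOn (fun u => (diamondPi 2 F p u : FiniteAdelicGL 2 F ⧸ 𝒰.level b c)) S
      (ArithmeticQuotient.doubleCosetQuot₂ (𝒰.level b' c) (𝒰.level b c) 1)) (i : ℕ)
    (x : LevelAction.cohomology (globalEmbedding 2 F) (integralMonoid F (padicPlace F p))
        (symLatticeAction (padicEmbInt F p) (PadicAlgCl p) F k (padicPlace F p) (padicEmbIntHom F p)) (𝒰.level b c) i) :
    (latticeRes F k p 𝒰 hb c i).hom ((latticeTr F k p 𝒰 b b' c i).hom x) =
      ∑ u ∈ S, latticeDiamond F k p h𝒰 b c i u x := by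
  have h' := congrArg ModuleCat.Hom.hom (latticeRes_latticeTr F k p hb hbc hS i)
  rw [ModuleCat.hom_comp, ModuleCat.hom_sum] at h'
  have h'' := LinearMap.congr_fun h' x
  rw [LinearMap.comp_apply, LinearMap.sum_apply] at h''
  exact h''

/-- **`⟨u⟩ ∘ res = res` for `u ∈ T(b')`**: `res` lands in the `T(b')/T(b)`-invariants of
`H^i(U(b,c), ⨂Sym(𝒪²))`. [cite: KhareThorne2017, §6.3] -/
theorem latticeDiamond_latticeRes_apply (h𝒰 : 𝒰.IsMaximalAbove) {b b' : ℕ} (hb : b' ≤ b) (c i : ℕ)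
    {u : ∀ w : PlacesAbove F p, (Fin 2 → (w.1.adicCompletionIntegers F)ˣ)} (hu : ∀ w, u w ∈ torusBall w.1 b')
    (x : LevelAction.cohomology (globalEmbedding 2 F) (integralMonoid F (padicPlace F p))
        (symLatticeAction (padicEmbInt F p) (PadicAlgCl p) F k (padicPlace F p) (padicEmbIntHom F p)) (𝒰.level b' c) i) :
    latticeDiamond F k p h𝒰 b c i u ((latticeRes F k p 𝒰 hb c i).hom x) = (latticeRes F k p 𝒰 hb c i).hom x := by
  have h' := congrArg ModuleCat.Hom.hom
    (resCohomology_heckeCohomology_of_mem (globalEmbedding 2 F) (integralMonoid F (padicPlace F p))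
      (symLatticeAction (padicEmbInt F p) (PadicAlgCl p) F k (padicPlace F p) (padicEmbIntHom F p))
      (level_le_integralMonoid F p 𝒰 b c) (level_le_integralMonoid F p 𝒰 b' c) (level_le_level F p hb c)
      (𝒰.diamondPi_mem_level h𝒰 c u hu) (fun x hx => diamondPi_normalizing F p h𝒰 b c u x hx) i)
  rw [ModuleCat.hom_comp] at h'
  exact LinearMap.congr_fun h' x

end ParallelWeight

end Literature.NumberTheory.Automorphic
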